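/-
COR-CM (cell pub-hodgecm2, stage 2 of the Hodge ladder) — TRANSPOSITION surge (COORDINATOR RULING — HODGE RE-POINT
2026-08-21T12:07:17Z (2)(3); hodge-director/TRANSPOSITION-MAP.md §0, seat ↔ item table): the TYPED INTERFACE for
DICTIONARY ITEM (v) of rfwf v3 §4.2.  Seat prover-pub-hodgecm2-tr-typer-5-0 (unit pub-hodgecm2-tr-typer-5), 2026-08-21.
`Prop`-valued definitions over explicit binders (binder style of the stage-1 `StubTree/Inputs.lean` / `Automorphic/ThetaFacts.lean`),
one two-field carrier for the two spans, and theorems.  Nothing asserted; no axiom; no `sorry`; `Interfaces.lean` (C1) untouched.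
FRAMING (COORDINATOR RULING 2026-08-21T11:55:35Z): `HC_CM` is NOT proved; this file proves no instance of any interface item.
-/
import Summits.HodgeConjecture.CorCM.B01.ThetaRealisationSocket
import HarnessLib

/-!
# Transposition item (v): seesaw ∕ `S₁₂` ∕ isolation (PerL Prop 3.6) ∕ the two spans coincide (PerL Thm 3.7) — typed interface

ITEM (v) of the six-item dictionary, rfwf v3 §4.2 `ss:audit`, tex ll.253–258 of
`run/shared/lean/pub/pub-hodgecm/inputs/2001/summits__hodge-w-rank-four-weil-faces__free__y1__paper__paper.tex`:
«[PerL, Lemma 3.4] (seesaw; multiplicativity of Kudla's splitting in orthogonal sums [HKS, GI]); [PerL, Lemma 3.5] (`S₁₂` is the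
closed span of wedges; Fock model of `(U(W_j), U(V₃))` at `ι₁`, [Y1neg, Lemma 3.1]); [PerL, Prop. 3.6] (isolation: pseudo-Eisenstein
series of the torus `T`, unfolding, Fourier expansion on the compact abelian group `[T]`, real approximation for the connected
reductive group `U(W)` over `F₀`); [PerL, Thm. 3.7] (the two spans coincide): general — the four types enter only through the
archimedean characters `w = (e_b(Ψ₁), e_b(Ψ₂))_b`, `w′ = (e_b(Ψ₃), e_b(Ψ₄))_b`.»

## TAG: **VERBATIM** (TRANSPOSITION-MAP.md §0-v3 FINAL NET «(v) wiring + its input hΘ_F by cite»; stage-1 lead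
`hodge-director/TRANSPOSITION-STAGE1.md` row (v) N17–N25; sinst-1 block «(v) model side VERBATIM as typed»).
ONE-LINE REASON: the isolation theorem is typed AND PROVED in the stage-1 package over ABSTRACT Hilbert-space data carrying no field,
degree, frame or sign-table binder — `Perl34.TorusData.C1_prop36` (PKG `Prior/Perl34.lean`:531), `Perl34.IsolationSetting.C2_thm37`
(:676), `C2_S12_eq_S34` (:685) —, its two Lemma-3.5 companions are typed `∀ {L : CMField} (V : HermSpace3 L ι₁) (c : SeesawCtx L),
T.GoodCtx ι₁ c → …` (`ThetaModel.Open_thetaGen12` PKG `Automorphic/ThetaFacts.lean`:199, `Open_thetaReal34` :213), and the wiring that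
consumes them is field-generic (`StubTree.thm44_of_realisation` PKG `StubTree/PerLProof.lean`:142, Steps 1–3 = :146–:158); a face
enters only through the archimedean weights `w, w′` of the two torus sides, read off `f.psi` (rfwf ll.257–258) — a by-name
re-instantiation at the face context `⟨F, f.psi, ι₁, D⟩` (PKG `Model/NonVacuity.lean`:191), no new estimate.  (PKG =
`run/shared/lean/pub/pub-hodgecm/lean/HodgeCMPerL/HodgeCM/`.)
STATUS IN STAGE 1 (not the tag): wiring + abstract isolation PROVED; the instance inputs `thetaGen12 ∕ thetaReal34 ∕ chars ∕ occ`
(`ThetaModel.Inputs`, `ThetaFacts.lean`:255–265) are discharged on the model inside the E term of record for the SEXTIC configuration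
only («JBUARM» `Model/E2InstanceOGR20AEPISTR2DJWHHTCGJBUARM.lean`:36, displayed cites [GR91 Prop 3.1.1] + [Liu 2021 Thm 4.18]); for
faces they are the content of B01 (this surge).  PARITY CAVEAT (b01-idea-2, hodge-director/INBOX l.343 (b)): the abstract Thm 3.7 is
parity-free; its hypothesis `H_chars` (`IsolationSetting.H_chars12/34` :309–315 = PerL Lemma 4.2(b) = `Open_chars` :229, filed under
item (vi) by rfwf) is where the flip-parity test bites — on the tree path below it is NOT a separate field (collapsed into
`IsolationSpans`, resp. into the inclusion `S₁₂ ≤ S₃₄` of §2), so whoever inhabits those on the model owes it there.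

## V-QUANTIFIER (RE-POINT (1); stage-2 lead §3 QUANTIFIER AUDIT, TRANSPOSITION-MAP.md l.63)
Item (v) is V-UNIFORM: a statement about a GIVEN `(ι₁, V)` and GIVEN theta sets `Θ i Γ` (chosen by items (ii)∕(iv)∕(vi)) inside the
`L²` space `HG` with embeddings `emb Γ` (chosen by item (iii)).  The `∃ ι₁ ∃ V` of the re-typed target is bound ONCE, outside, in
`Universe.FaceThetaDataExists` (`Transposition/Assembly.lean`, p271429).  Inside the datum PerL delivers the ∀-form (`S₁₂ = S₃₄`:
EVERY theta (12)-wedge-function couples — `IsolationSpans` below), while the engine consumes only an ∃-form jointly with item (vi)'s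
line field (ONE theta (12)-wedge-function not orthogonal to ONE theta (34)-wedge-function — `WedgePairingExists` below); ∀ ⇒ ∃ is
`wedgePairingExists_of_lineField`, and `periodNV_of_wedgePairingExists` shows the ∃-form already runs the engine.

## STAGE-1 ∕ TREE DECLARATIONS THIS FILE GENERALISES (file:line)
* PKG `Universe.ThetaRealisation.gen12` (`Automorphic/Realisation.lean`:136–137) and `ThetaModel.Open_thetaGen12`
  (`Automorphic/ThetaFacts.lean`:199–203) ↦ `IsolationSpans.Gen12`;
* PKG `Universe.ThetaRealisation.real34` (`Automorphic/Realisation.lean`:143–145) and `ThetaModel.Open_thetaReal34` (`ThetaFacts.lean`:213–217)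
  ↦ `IsolationSpans.Real34` (tree form: the GENERATORS `ϑ_{T′,χ}(Φ)` of `S₃₄` are not tree objects, so `Real34` bounds the span `S₃₄`
  itself by the closed span of the theta (34)-wedge-functions — equivalent to the PKG form given `TorusData.S12_def` :210 and
  `Submodule.topologicalClosure_minimal`);
* PKG `Perl34.IsolationSetting.C2_S12_eq_S34` (`Prior/Perl34.lean`:685; from `C2_thm37` :676 and `C1_prop36` :531 under `H_chars12/34`
  :309–315 and `H_occ12/34` :316–321 = PerL Lemma 4.1(c) = `Open_occ` `ThetaFacts.lean`:241) ↦ `IsolationSpans.SpansCoincide`; only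
  `S₁₂ ≤ S₃₄` is consumed (hypothesis `hle` of `IsolationSpans.of_gen12_le_real34`; PKG docstring `Realisation.lean`:99–101: the
  symmetric statements are not consumed);
* PKG `StubTree.thm44_of_realisation` Steps 1–3 (`StubTree/PerLProof.lean`:146–158) ↦ `IsolationSpans.of_gen12_le_real34` and
  `wedgePairingExists_of_lineField`; Steps 4–6 (:159–:188) ↦ `periodNV_of_wedgePairingExists`;
* TREE `Universe.FaceThetaDatum.coupling` (`B01/ThetaRealisationSocket.lean`:83–86, the collapsed socket field) ↦ `IsolationSpans`
  (literally its body: `IsolationSpans.coupling`, `IsolationSpans.of_faceThetaDatum`, `IsolationSpans.faceThetaDatum`).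
Cohomological shadows one level down, BY NAME only (not on this path): B01-O `Universe.FaceWedgeOverlap` (`B01/FaceInputsSplit.lean`:101;
∀(Γ, ω₀, ω₁) over all of `Uiso` with Hecke spans — demands theta-exhaustion and finite-level descent beyond item (v), b01-x1
`pub-hodgecm2/INBOX.md` l.3673 (c)(d)); the one-level ∃-meet `FaceWedgeMeet` (b01-x1 sketch md5 4093e6676e04, unfiled offer, lead ruling l.3680).

## Contents (namespace `Summit.HodgeConjecture.CorCM.Transposition`)
* `thetaWedgeFns U emb Θ i j` — the set of theta `(ij)`-wedge-functions `emb Γ (ω ∪ ω′)`, `ω ∈ Θ i Γ`, `ω′ ∈ Θ j Γ`, over ALL levels.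
* `IsolationSpans U emb Θ` — THE INTERFACE ITEM OF RECORD for (v) (= the socket field `coupling`): every theta (12)-wedge-function lies
  in the closed span of the theta (34)-wedge-functions.  Projections: `IsolationSpans.coupling` (the field's type verbatim),
  `IsolationSpans.of_faceThetaDatum`, and the assembly-shaped constructor `IsolationSpans.faceThetaDatum`.
* `IsolationSpans.Datum` (`S12`, `S34`), `Gen12`, `SpansCoincide`, `Real34`, `IsolationSpans.of_gen12_le_real34` ∕
  `of_gen12_spansCoincide_real34` — the manuscript-shaped refinement: three separately dischargeable targets and their proved
  composition (= thm44 Steps 1–3); `refinement_of_isolationSpans` records that the refinement adds bookkeeping, not strength.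

TAGGING: the five `Prop`-valued interface items (`IsolationSpans`, `Gen12`, `SpansCoincide`, `Real34`, `WedgePairingExists`) carry
`@[conjecture]` (displayed, provable ∕ refutable by name per datum — the convention of `B01/FaceInputsSplit.lean` and
`Transposition/Assembly.lean`); the data (`thetaWedgeFns`, `IsolationSpans.Datum`, `IsolationSpans.faceThetaDatum`) and the theorems do not.
* `WedgePairingExists U emb Θ` — the ∃-form jointly consumed with item (vi)'s line field; `wedgePairingExists_of_lineField`;
  `periodNV_of_wedgePairingExists` — the engine from the ∃-form (with item (iii)'s `cover ∕ emb_cover ∕ inner_emb` and (ii)∕(vi)'s `Theta_sub`).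
-/

noncomputable section

open scoped TensorProduct InnerProductSpace

namespace Summit.HodgeConjecture.CorCM

open Literature.AlgebraicGeometry.Motives (CMType HodgeStructure)
open Literature.AlgebraicGeometry.Motives.HodgeStructure (conj)

namespace Transposition

variable (U : Universe) {L : CMField} {ι₁ : L →+* ℂ} {V : HermSpace3 L ι₁}
  {HG : Type*} [NormedAddCommGroup HG] [InnerProductSpace ℂ HG]
  (emb : ∀ Γ : Level V, U.CohC (U.pms L ι₁ V Γ) 2 →ₗ[ℂ] HG)
  (Θ : Fin 4 → ∀ Γ : Level V, Set (U.CohC (U.pms L ι₁ V Γ) 1))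

/-! ## §1  The interface item of record: `IsolationSpans` (= the socket field `coupling`) -/

/-- The THETA `(ij)`-WEDGE-FUNCTIONS over all levels: the `L²`-images `emb Γ (ω ∪ ω′)` of the wedges of a theta one-form
`ω ∈ Θ i Γ` with a theta one-form `ω′ ∈ Θ j Γ`, `Γ` any level (PerL §3.1 eq. (Qaut) + Lemma 3.4: in the model these are the
products `θ_{φ}(χ′) · θ_{φ′}(χ″)` on `[G_U]`).  For `(i,j) = (2,3)` this is the generating set in the socket field
`FaceThetaDatum.coupling` (`B01/ThetaRealisationSocket.lean`:85–86) and in PKG `ThetaRealisation.real34` (`Realisation.lean`:145). [folklore] -/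
def thetaWedgeFns (i j : Fin 4) : Set HG :=
  {x : HG | ∃ (Γ : Level V), ∃ ω ∈ Θ i Γ, ∃ ω' ∈ Θ j Γ, x = emb Γ (U.cup2C (U.pms L ι₁ V Γ) 1 ω ω')}

/-- **Item (v), interface of record — `IsolationSpans`** (PerL Thm 3.7 with Lemma 3.5 in both directions, COLLAPSED to what the
engine consumes; rfwf v3 §4.2 (v), tex ll.253–258): for the given `(ι₁, V)`, the given `L²`-embeddings `emb Γ : H²(P_Γ, ℂ) → HG` (item
(iii)) and the given theta one-form sets `Θ i Γ` (items (ii)∕(iv)∕(vi)), EVERY theta (12)-wedge-function `emb Γ (ω₁ ∪ ω₂)`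
(`ω₁ ∈ Θ 0 Γ`, `ω₂ ∈ Θ 1 Γ`) lies in the CLOSED span of ALL theta (34)-wedge-functions (over all levels).  This is, symbol for
symbol, the type of the socket field `Universe.FaceThetaDatum.coupling` (`B01/ThetaRealisationSocket.lean`:83–86) with `emb`, `Theta`
free; generalises PKG `gen12` + `S.C2_S12_eq_S34` + `real34` as composed in `thm44_of_realisation` Steps 1–3
(`StubTree/PerLProof.lean`:146–158).  V-uniform (no `∃ V` inside).  Displayed interface item; asserted by no one. -/
@[conjecture]
def IsolationSpans : Prop :=
  ∀ (Γ : Level V) (ω₁ ω₂ : U.CohC (U.pms L ι₁ V Γ) 1), ω₁ ∈ Θ 0 Γ → ω₂ ∈ Θ 1 Γ →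
    emb Γ (U.cup2C (U.pms L ι₁ V Γ) 1 ω₁ ω₂) ∈ (Submodule.span ℂ (thetaWedgeFns U emb Θ 2 3)).topologicalClosure

namespace IsolationSpans

variable {U emb Θ}

/-- **Projection into the socket** (the one line the day-1 assembly consumes): `IsolationSpans U emb Θ` IS the field `coupling` of
`Universe.FaceThetaDatum` (`B01/ThetaRealisationSocket.lean`:83–86) for a datum with `emb := emb`, `Theta := Θ` — stated with the
field's type written out verbatim. [folklore] -/
theorem coupling (h : IsolationSpans U emb Θ) :
    ∀ (Γ : Level V) (ω₁ ω₂ : U.CohC (U.pms L ι₁ V Γ) 1), ω₁ ∈ Θ 0 Γ → ω₂ ∈ Θ 1 Γ →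
      emb Γ (U.cup2C (U.pms L ι₁ V Γ) 1 ω₁ ω₂) ∈ (Submodule.span ℂ
        {x : HG | ∃ (Γ' : Level V), ∃ ω₃ ∈ Θ 2 Γ', ∃ ω₄ ∈ Θ 3 Γ',
          x = emb Γ' (U.cup2C (U.pms L ι₁ V Γ') 1 ω₃ ω₄)}).topologicalClosure :=
  h

/-- **Projection out of the socket**: the `coupling` field of any face-scoped theta datum is an instance of `IsolationSpans`
(consistency check that the interface item is literally the socket's slot). [folklore] -/
theorem of_faceThetaDatum {K : CMField} {Ψ : Fin 4 → CMType K} {σ : K →+* ℂ} (R : U.FaceThetaDatum ι₁ V K Ψ σ) :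
    IsolationSpans U R.emb R.Theta :=
  R.coupling

/-- **Assembly shape** (demonstration only — the assembly of record `Item1 → … → Item6 → FaceThetaDataExists` is the stage-2 lead's,
`Transposition/Assembly.lean`): item (iii)'s `(HG, emb, cover, emb_cover, inner_emb)`, items (ii)∕(iv)∕(vi)'s `(Θ, Theta_sub, lineField)`
and item (v)'s `IsolationSpans U emb Θ` are EXACTLY the fields of `Universe.FaceThetaDatum ι₁ V K Ψ σ`
(`B01/ThetaRealisationSocket.lean`:66–95; face setting `K = L = F`, `Ψ = f.psi`, `σ = ι₁`).  `HG` in `Type` as the socket demands. [folklore] -/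
def faceThetaDatum {HG₀ : Type} [NormedAddCommGroup HG₀] [InnerProductSpace ℂ HG₀]
    (emb₀ : ∀ Γ : Level V, U.CohC (U.pms L ι₁ V Γ) 2 →ₗ[ℂ] HG₀)
    (Θ₀ : Fin 4 → ∀ Γ : Level V, Set (U.CohC (U.pms L ι₁ V Γ) 1))
    {K : CMField} {Ψ : Fin 4 → CMType K} {σ : K →+* ℂ}
    (Theta_sub : ∀ (i : Fin 4) (Γ : Level V), Θ₀ i Γ ⊆ U.Uiso Γ K (Ψ i) σ)
    (lineField : ∃ (Γ : Level V), ∃ ω₁ ∈ Θ₀ 0 Γ, ∃ ω₂ ∈ Θ₀ 1 Γ, emb₀ Γ (U.cup2C (U.pms L ι₁ V Γ) 1 ω₁ ω₂) ≠ 0)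
    (h : IsolationSpans U emb₀ Θ₀)
    (cover : ∀ (Γ Γ' : Level V), Γ' ≤ Γ → U.Mor (U.pms L ι₁ V Γ') (U.pms L ι₁ V Γ))
    (emb_cover : ∀ (Γ Γ' : Level V) (hle : Γ' ≤ Γ) (x : U.CohC (U.pms L ι₁ V Γ) 2),
      emb₀ Γ' (U.pullC (cover Γ Γ' hle) 2 x) = emb₀ Γ x)
    (inner_emb : ∀ Γ : Level V, ∃ c : ℂ, c ≠ 0 ∧ ∀ x y : U.CohC (U.pms L ι₁ V Γ) 2,
      x ∈ (U.hodge (U.pms L ι₁ V Γ) 2).F 2 → y ∈ (U.hodge (U.pms L ι₁ V Γ) 2).F 2 →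
        ⟪emb₀ Γ y, emb₀ Γ x⟫_ℂ = c * U.trC (U.pms L ι₁ V Γ) 4 (U.cup2C (U.pms L ι₁ V Γ) 2 x (conj y))) :
    U.FaceThetaDatum ι₁ V K Ψ σ where
  HG := HG₀
  emb := emb₀
  Theta := Θ₀
  Theta_sub := Theta_sub
  lineField := lineField
  coupling := h
  cover := cover
  emb_cover := emb_cover
  inner_emb := inner_emb

end IsolationSpans

/-! ## §2  The manuscript-shaped refinement: `S₁₂`, `S₃₄`, Lemma 3.5 (both directions), Thm 3.7, and their composition -/

/-- **The two spans** of PerL §3.3 as bare data inside `HG = L²([G_U])` (tex ll.348–349): `S₁₂` = the closed span of the theta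
FUNCTIONS `ϑ_{T,χ}(Φ)` over the (12) torus side `(T, w)`, `S₃₄` = the same over the (34) side `(T′, w′)` (PKG `Perl34.TorusData.S12`
`Prior/Perl34.lean`:206 with `S12_def` :210, once per side of `Perl34.IsolationSetting` :298–307).  The tree has no theta-kernel
language, so the two submodules are carried as DATA to be supplied by the model-side construction together with proofs of `Gen12`,
`SpansCoincide` (or just `S₁₂ ≤ S₃₄`) and `Real34`; closedness is true by construction there and is not consumed here. [folklore] -/
structure IsolationSpans.Datum (HG : Type*) [NormedAddCommGroup HG] [InnerProductSpace ℂ HG] where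
  /-- `S₁₂ ⊆ L²([G_U])` (PerL l.348; PKG `IsolationSetting.t12.S12`) -/
  S12 : Submodule ℂ HG
  /-- `S₃₄ ⊆ L²([G_U])` (PerL l.349; PKG `IsolationSetting.t34.S12`) -/
  S34 : Submodule ℂ HG

namespace IsolationSpans

variable (D : IsolationSpans.Datum HG)

/-- **PerL Lemma 3.4 + Lemma 3.5, seesaw direction, pair (12)** (tex ll.350–396; Kudla's splitting [HKS, GI]; rfwf item (v)): the
`L²`-function of the wedge of a theta one-form of type `Ψ₀` with one of type `Ψ₁` lies in `S₁₂` — it IS a generator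
`ϑ_{T,χ₁χ₂}(Φ₁ ⊗ Φ₂)` by the seesaw identity.  Generalises PKG `ThetaRealisation.gen12` (`Realisation.lean`:136–137) ∕
`ThetaModel.Open_thetaGen12` (`ThetaFacts.lean`:199–203; typed `∀ {L : CMField} (V) (c : SeesawCtx L), GoodCtx → …`).  Displayed
interface item; not asserted. -/
@[conjecture]
def Gen12 : Prop :=
  ∀ (Γ : Level V) (ω₁ ω₂ : U.CohC (U.pms L ι₁ V Γ) 1), ω₁ ∈ Θ 0 Γ → ω₂ ∈ Θ 1 Γ →
    emb Γ (U.cup2C (U.pms L ι₁ V Γ) 1 ω₁ ω₂) ∈ D.S12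

/-- **PerL Thm 3.7 — the two spans coincide** (`thm:R`, tex ll.440–458; from Prop 3.6 `prop:isol` ll.397–439 under `H_chars` =
Lemma 4.2(b) and `H_occ` = Lemma 4.1(c)): `S₁₂ = S₃₄`.  PROVED abstractly in the stage-1 package: `Perl34.IsolationSetting.C2_S12_eq_S34`
(`Prior/Perl34.lean`:685) over `IsolationSetting` (:298; Hilbert spaces, a unitary action, kernel operators — no field, no degree);
what a face owes is the INSTANCE (the isolation setting of the seesaw plane `W ⊂ V` with the archimedean weights `w, w′` of `f.psi`)
with its hypotheses `H_chars12/34` (:309–315) and `H_occ12/34` (:316–321).  rfwf ll.257–258: «general — the four types enter only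
through w, w′».  Only the inclusion `S₁₂ ≤ S₃₄` is consumed downstream (PKG `thm44_of_realisation` Step 1 rewrites along
`C2_S12_eq_S34` and uses only it, `PerLProof.lean`:148–150).  PARITY CAVEAT: `H_chars` is where b01-idea-2's flip-parity test
applies (hodge-director/INBOX l.343 (b)).  Displayed interface item; not asserted. -/
@[conjecture]
def SpansCoincide : Prop :=
  D.S12 = D.S34

/-- **PerL Lemma 3.5, generation direction, pair (34), CLOSURE form** (`lem:S12`, tex ll.350–353 with 381–396; rfwf item (v)): `S₃₄`
is contained in the closed span of the theta (34)-wedge-functions over all levels (Fock-polynomial `Φ`: a finite sum of wedges at a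
deep enough torsion-free level, Matsushima–Murakami; general Schwartz `Φ` by density and continuity of `Φ ↦ ϑ`).  Generalises PKG
`ThetaRealisation.real34` (`Realisation.lean`:143–145) ∕ `ThetaModel.Open_thetaReal34` (`ThetaFacts.lean`:213–217), which bound each
GENERATOR `ϑ_{T′,χ}(Φ)`; bounding the closed span `S₃₄` is equivalent (`TorusData.S12_def` :210, `Submodule.topologicalClosure_minimal`).
Displayed interface item; not asserted. -/
@[conjecture]
def Real34 : Prop :=
  D.S34 ≤ (Submodule.span ℂ (thetaWedgeFns U emb Θ 2 3)).topologicalClosure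

variable {U emb Θ D}

/-- **Composition = PKG `thm44_of_realisation` Steps 1–3** (`StubTree/PerLProof.lean`:146–158): Lemma 3.5 (seesaw direction) puts a
theta (12)-wedge-function in `S₁₂`; Thm 3.7 moves it to `S₃₄`; Lemma 3.5 (generation direction, closure form) puts `S₃₄` inside the
closed span of the theta (34)-wedge-functions.  Only the inclusion `S₁₂ ≤ S₃₄` of Thm 3.7 is used.  Hence the interface item of
record. [folklore] -/
theorem of_gen12_le_real34 (hg : Gen12 U emb Θ D) (hle : D.S12 ≤ D.S34) (hr : Real34 U emb Θ D) :
    IsolationSpans U emb Θ :=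
  fun Γ ω₁ ω₂ h₁ h₂ => hr (hle (hg Γ ω₁ ω₂ h₁ h₂))

/-- The same from the full Thm 3.7. [folklore] -/
theorem of_gen12_spansCoincide_real34 (hg : Gen12 U emb Θ D) (he : SpansCoincide D) (hr : Real34 U emb Θ D) :
    IsolationSpans U emb Θ :=
  of_gen12_le_real34 hg he.le hr

/-- Conversely the collapsed item is the refinement for the TRIVIAL datum `S₁₂ = S₃₄ :=` the closed span of the theta
(34)-wedge-functions — recorded to make plain that the refinement adds bookkeeping (three named targets matching PerL's lemmas), not
logical strength; the strength sits in WHICH `S₁₂, S₃₄` the model supplies (the theta-function spans of the two torus sides). [folklore] -/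
theorem refinement_of_isolationSpans (h : IsolationSpans U emb Θ) :
    ∃ D : IsolationSpans.Datum HG, Gen12 U emb Θ D ∧ SpansCoincide D ∧ Real34 U emb Θ D :=
  ⟨⟨(Submodule.span ℂ (thetaWedgeFns U emb Θ 2 3)).topologicalClosure,
    (Submodule.span ℂ (thetaWedgeFns U emb Θ 2 3)).topologicalClosure⟩, h, rfl, le_rfl⟩

end IsolationSpans

/-! ## §3  The ∃-form the engine consumes (jointly with item (vi)'s line field), and the engine from it -/

/-- **`WedgePairingExists`** — the ∃-form of items (v)+(vi-wedge) that the engine actually consumes (RE-POINT (1) «the quantifiers PerL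
actually delivers», read one step further inside the datum): SOME theta (12)-wedge-function (at some level `Γ`) is NOT orthogonal in
`HG = L²([G_U])` to SOME theta (34)-wedge-function (at some level `Γ′`).  PerL delivers more (`S₁₂ = S₃₄` and a non-zero (12)-wedge:
`wedgePairingExists_of_lineField`); the period engine needs only this (`periodNV_of_wedgePairingExists`).  V-uniform.  Mathlib's inner
product is conjugate-linear in the first slot, whence the order (as in `FaceThetaDatum.inner_emb`).  Displayed interface item; not
asserted. -/
@[conjecture]
def WedgePairingExists : Prop :=
  ∃ (Γ : Level V), ∃ ω₁ ∈ Θ 0 Γ, ∃ ω₂ ∈ Θ 1 Γ, ∃ (Γ' : Level V), ∃ ω₃ ∈ Θ 2 Γ', ∃ ω₄ ∈ Θ 3 Γ',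
    ⟪emb Γ' (U.cup2C (U.pms L ι₁ V Γ') 1 ω₃ ω₄), emb Γ (U.cup2C (U.pms L ι₁ V Γ) 1 ω₁ ω₂)⟫_ℂ ≠ 0

variable {U emb Θ}

/-- **∀ ⇒ ∃ (PKG `thm44_of_realisation` Steps 1–3, `PerLProof.lean`:146–158; tree engine `periodNV_of_faceThetaDatum` Steps 1–2, `ThetaRealisationSocket.lean`
:110–116):** item (vi)'s line field (PerL Prop 4.3: a theta (12)-wedge with non-zero `L²`-image, the type of `FaceThetaDatum.lineField`
:79–80) and item (v)'s `IsolationSpans` give `WedgePairingExists` — a non-zero vector in the closed span of a set is not orthogonal to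
some member of the set (`exists_inner_ne_zero_of_mem_closure_span`, :47). [folklore] -/
theorem wedgePairingExists_of_lineField
    (hline : ∃ (Γ : Level V), ∃ ω₁ ∈ Θ 0 Γ, ∃ ω₂ ∈ Θ 1 Γ, emb Γ (U.cup2C (U.pms L ι₁ V Γ) 1 ω₁ ω₂) ≠ 0)
    (h : IsolationSpans U emb Θ) : WedgePairingExists U emb Θ := by
  obtain ⟨Γ, ω₁, hω₁, ω₂, hω₂, hv⟩ := hline
  obtain ⟨u, ⟨Γ', ω₃, hω₃, ω₄, hω₄, rfl⟩, hu⟩ :=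
    exists_inner_ne_zero_of_mem_closure_span (inner_self_ne_zero.mpr hv) (h Γ ω₁ ω₂ hω₁ hω₂)
  refine ⟨Γ, ω₁, hω₁, ω₂, hω₂, Γ', ω₃, hω₃, ω₄, hω₄, ?_⟩
  intro h0
  apply hu
  rw [← inner_conj_symm, h0, map_zero]

/-- The same out of a socket datum (its `lineField` and `coupling` fields). [folklore] -/
theorem wedgePairingExists_of_faceThetaDatum {K : CMField} {Ψ : Fin 4 → CMType K} {σ : K →+* ℂ}
    (R : U.FaceThetaDatum ι₁ V K Ψ σ) : WedgePairingExists U R.emb R.Theta :=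
  wedgePairingExists_of_lineField R.lineField (IsolationSpans.of_faceThetaDatum R)

/-- **The period engine from the ∃-form** (PKG `thm44_of_realisation` Steps 4–6, `StubTree/PerLProof.lean`:159–188; tree
`periodNV_of_faceThetaDatum` Steps 3–5, `ThetaRealisationSocket.lean`:117–161, with Steps 1–2 replaced by the hypothesis
`WedgePairingExists`): given item (iii)'s level coverings with `emb_cover` and «Petersson = period» `inner_emb`, and items (ii)∕(vi)'s
typing `Θ i Γ ⊆ U_{Ψ i}(Γ)`, ONE non-orthogonal pair of theta wedge-functions yields `U.PeriodNV ι₁ V K Ψ σ`: common level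
(`Level.exists_le_le`; `U_Ψ` pull-back stable by `Fact_pull_comp`; `Fact_pull_cup`), Petersson = period on `(2,0)`-wedges
(`cup2C_mem_F_two_of_Uiso`, `period_eq_pairing_wedges`), multilinear expansion (`periodNV_of_period_ne_zero`).  So on the path
`Item1…6 → FaceThetaDataExists → HC_CM` nothing stronger than `WedgePairingExists` is used of items (v)+(vi-wedge). [folklore] -/
theorem periodNV_of_wedgePairingExists (hc : U.Fact_pull_comp) (hH : U.Fact_pull_hodge) (hcup2 : U.Fact_cup2_hodge)
    (hpc : U.Fact_pull_cup) {K : CMField} {Ψ : Fin 4 → CMType K} {σ : K →+* ℂ}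
    (Theta_sub : ∀ (i : Fin 4) (Γ : Level V), Θ i Γ ⊆ U.Uiso Γ K (Ψ i) σ)
    (cover : ∀ (Γ Γ' : Level V), Γ' ≤ Γ → U.Mor (U.pms L ι₁ V Γ') (U.pms L ι₁ V Γ))
    (emb_cover : ∀ (Γ Γ' : Level V) (hle : Γ' ≤ Γ) (x : U.CohC (U.pms L ι₁ V Γ) 2),
      emb Γ' (U.pullC (cover Γ Γ' hle) 2 x) = emb Γ x)
    (inner_emb : ∀ Γ : Level V, ∃ c : ℂ, c ≠ 0 ∧ ∀ x y : U.CohC (U.pms L ι₁ V Γ) 2,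
      x ∈ (U.hodge (U.pms L ι₁ V Γ) 2).F 2 → y ∈ (U.hodge (U.pms L ι₁ V Γ) 2).F 2 →
        ⟪emb Γ y, emb Γ x⟫_ℂ = c * U.trC (U.pms L ι₁ V Γ) 4 (U.cup2C (U.pms L ι₁ V Γ) 2 x (conj y)))
    (h : WedgePairingExists U emb Θ) : U.PeriodNV ι₁ V K Ψ σ := by
  obtain ⟨Γ₁, ω₁, hω₁, ω₂, hω₂, Γ₂, ω₃, hω₃, ω₄, hω₄, hu⟩ := h
  -- pass to a common level Γ ≤ Γ₁, Γ₂
  obtain ⟨Γ, hΓ₁, hΓ₂⟩ := Level.exists_le_le Γ₁ Γ₂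
  let a := U.pullC (cover Γ₁ Γ hΓ₁) 1 ω₁
  let b := U.pullC (cover Γ₁ Γ hΓ₁) 1 ω₂
  let c₃ := U.pullC (cover Γ₂ Γ hΓ₂) 1 ω₃
  let c₄ := U.pullC (cover Γ₂ Γ hΓ₂) 1 ω₄
  have ha : a ∈ U.Uiso Γ K (Ψ 0) σ := Universe.pullC_mem_Uiso hc _ K (Ψ 0) σ (Theta_sub 0 Γ₁ hω₁)
  have hb : b ∈ U.Uiso Γ K (Ψ 1) σ := Universe.pullC_mem_Uiso hc _ K (Ψ 1) σ (Theta_sub 1 Γ₁ hω₂)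
  have hc₃ : c₃ ∈ U.Uiso Γ K (Ψ 2) σ := Universe.pullC_mem_Uiso hc _ K (Ψ 2) σ (Theta_sub 2 Γ₂ hω₃)
  have hc₄ : c₄ ∈ U.Uiso Γ K (Ψ 3) σ := Universe.pullC_mem_Uiso hc _ K (Ψ 3) σ (Theta_sub 3 Γ₂ hω₄)
  -- the wedge-functions at the common level
  have e12 : emb Γ (U.cup2C (U.pms L ι₁ V Γ) 1 a b) = emb Γ₁ (U.cup2C (U.pms L ι₁ V Γ₁) 1 ω₁ ω₂) := by
    rw [show U.cup2C (U.pms L ι₁ V Γ) 1 a b = U.pullC (cover Γ₁ Γ hΓ₁) (1 + 1) (U.cup2C _ 1 ω₁ ω₂) from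
      (Universe.pullC_cup2C hpc _ 1 ω₁ ω₂).symm]
    exact emb_cover Γ₁ Γ hΓ₁ _
  have e34 : emb Γ (U.cup2C (U.pms L ι₁ V Γ) 1 c₃ c₄) = emb Γ₂ (U.cup2C (U.pms L ι₁ V Γ₂) 1 ω₃ ω₄) := by
    rw [show U.cup2C (U.pms L ι₁ V Γ) 1 c₃ c₄ = U.pullC (cover Γ₂ Γ hΓ₂) (1 + 1) (U.cup2C _ 1 ω₃ ω₄) from
      (Universe.pullC_cup2C hpc _ 1 ω₃ ω₄).symm]
    exact emb_cover Γ₂ Γ hΓ₂ _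
  -- Petersson = period at level Γ
  obtain ⟨c, -, hcΛ⟩ := inner_emb Γ
  have hx : U.cup2C (U.pms L ι₁ V Γ) 1 a b ∈ (U.hodge (U.pms L ι₁ V Γ) (1 + 1)).F (1 + 1) :=
    Universe.cup2C_mem_F_two_of_Uiso hH hcup2 Γ K (Ψ 0) (Ψ 1) σ ha hb
  have hy : U.cup2C (U.pms L ι₁ V Γ) 1 c₃ c₄ ∈ (U.hodge (U.pms L ι₁ V Γ) (1 + 1)).F (1 + 1) :=
    Universe.cup2C_mem_F_two_of_Uiso hH hcup2 Γ K (Ψ 2) (Ψ 3) σ hc₃ hc₄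
  have hinner : ⟪emb Γ (U.cup2C _ 1 c₃ c₄), emb Γ (U.cup2C _ 1 a b)⟫_ℂ ≠ 0 := by
    rw [e12, e34]
    exact hu
  have hper : U.period (U.pms L ι₁ V Γ) ![a, b, c₃, c₄] ≠ 0 := by
    have hΛ := hcΛ (U.cup2C _ 1 a b) (U.cup2C _ 1 c₃ c₄) hx hy
    rw [Universe.period_eq_pairing_wedges]
    simp only [Matrix.cons_val_zero, Matrix.cons_val_one, Matrix.cons_val]
    intro h0
    apply hinner
    rw [hΛ]
    exact mul_eq_zero_of_right c h0
  -- multilinear expansion to pure pull-backs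
  refine Universe.periodNV_of_period_ne_zero Γ _ (fun i => ?_) hper
  match i with
  | 0 => exact ha
  | 1 => exact hb
  | 2 => exact hc₃
  | 3 => exact hc₄

/-- **Item (v) runs the engine**: `IsolationSpans` + item (vi)'s line field + item (iii)'s bookkeeping + items (ii)∕(vi)'s typing ⇒
`U.PeriodNV ι₁ V K Ψ σ` — the tree engine `periodNV_of_faceThetaDatum` (`ThetaRealisationSocket.lean`:106) re-assembled through
`WedgePairingExists`, so that the two routes provably agree. [folklore] -/
theorem IsolationSpans.periodNV (hc : U.Fact_pull_comp) (hH : U.Fact_pull_hodge) (hcup2 : U.Fact_cup2_hodge)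
    (hpc : U.Fact_pull_cup) {K : CMField} {Ψ : Fin 4 → CMType K} {σ : K →+* ℂ}
    (Theta_sub : ∀ (i : Fin 4) (Γ : Level V), Θ i Γ ⊆ U.Uiso Γ K (Ψ i) σ)
    (lineField : ∃ (Γ : Level V), ∃ ω₁ ∈ Θ 0 Γ, ∃ ω₂ ∈ Θ 1 Γ, emb Γ (U.cup2C (U.pms L ι₁ V Γ) 1 ω₁ ω₂) ≠ 0)
    (h : IsolationSpans U emb Θ)
    (cover : ∀ (Γ Γ' : Level V), Γ' ≤ Γ → U.Mor (U.pms L ι₁ V Γ') (U.pms L ι₁ V Γ))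
    (emb_cover : ∀ (Γ Γ' : Level V) (hle : Γ' ≤ Γ) (x : U.CohC (U.pms L ι₁ V Γ) 2),
      emb Γ' (U.pullC (cover Γ Γ' hle) 2 x) = emb Γ x)
    (inner_emb : ∀ Γ : Level V, ∃ c : ℂ, c ≠ 0 ∧ ∀ x y : U.CohC (U.pms L ι₁ V Γ) 2,
      x ∈ (U.hodge (U.pms L ι₁ V Γ) 2).F 2 → y ∈ (U.hodge (U.pms L ι₁ V Γ) 2).F 2 →
        ⟪emb Γ y, emb Γ x⟫_ℂ = c * U.trC (U.pms L ι₁ V Γ) 4 (U.cup2C (U.pms L ι₁ V Γ) 2 x (conj y))) :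
    U.PeriodNV ι₁ V K Ψ σ :=
  periodNV_of_wedgePairingExists hc hH hcup2 hpc Theta_sub cover emb_cover inner_emb
    (wedgePairingExists_of_lineField lineField h)

end Transposition

end Summit.HodgeConjecture.CorCM

end
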